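import Summits.BirchSwinnertonDyer.Rank1Residual.GaloisImage.KatoKuriharaValueRowsOfZetaBody
import HarnessLib

/-!
# Route `KimAtThreeKolyvagin` (W2): the `p`-SCALED zeta body and the integral lift of the `p`-scaled twist —
# the two lemmas of T-PK6-VDIS that read the additive guard `p² ∣ N`, re-done WITHOUT it

Cell `bsd-addord`, seat `bsd-addord-w2-c4` (gen 8; owner of crux 19599 `ShallowEqDeepOffKatoStratum`, item
19077 `ShallowEqDeepAtTorsionFree`).  `--supports` 19599.  HONEST FRAMING: TOOL THEOREMS ONLY (no definition,
no named fact, no instance, no `sorry`); Kato's cited matrix `ZetaBody` enters as the displayed HYPOTHESIS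
`hbody` (never obtained); nothing is booked; 19599 / 19077 / 19560 stay OPEN; BSD is not proved by any of this.
Credit: the value-row machine is n1011's (cell `b2b-bsdres`, seats p02 / p13 / p15: `ValueRow.valueRow_of_zetaBody`,
`exists_padicLift_twist`, `isUnit_sum_coeff_twist_of_certificates`), used BY NAME; only the two lemmas that read
`p² ∣ N` are re-done here; the sequel `KimAtThreeShallowEqDeepValueRowsNonAdd` runs T-PK6-VDIS on the scaled body.

## Why (the off-Kato-stratum port of W2 at a NON-additive `3`)

n1011's T-PK6-VDIS (`ValueRow.valueRow_of_zetaBody`) discharges ★ PK-6₂'s value rows `hvalue` from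
`ZetaBody` under the guard `p² ∣ N` (additive reduction at `p`: `a_p(f) = 0`, Atkin–Lehner), used at ONE place
only: it makes the `p`-Euler factor `E_p = 1 − (a_p/p)σ_p⁻¹ + (𝟙_{p∤N}/p)σ_p⁻²` of the depleted value law
(`S = prime(m·p·A)`, Kato §6.2) equal to `1`, so that the rational twist `Vq = (1 + δ₋₁)·uκδ_{u⁻¹}·∏_{q∣pA}E_q·C⁻`
has `p`-integral scalars and lifts to `ℤ_p[(ℤ/n)ˣ]`.  At a good or multiplicative `p` the scalars `a_p/p`,
`1/p` are not `p`-integral — but `p·E_p = p − a_pσ_p⁻¹ + 𝟙σ_p⁻²` IS, with augmentation `p + 𝟙 − a_p`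
(`= #Ẽ(𝔽_p)` at a good `p`, `= p ∓ 1` at a multiplicative `p`).  Scaling Kato's witnesses by `p`
(`κ ↦ p·κ`, `Λ ↦ p•Λ`, `x ↦ p•x`; §1: `ZetaBody` is homogeneous in `(κ, Λ, x)`, classes `z` untouched) turns the
twist into `p·Vq`, which lifts (§2) and has unit augmentation exactly when
`v_p(p · ∏_{q∣pA}(1 − a_q/q + 𝟙_{q∤N}/q)) = 0` — the NON-ANOMALOUS depletion certificate (§2).  On a `t = 0`
row with good non-anomalous, supersingular or multiplicative (`p ∤ c_p`) reduction the dual-exponential lattice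
is `exp*_ω(H¹(ℚ_p,T)) = p⁻¹ℤ_p` uniformly in the unramified `p`-power tower (Kim AJM 148 Lemma 3.3 / the
Tate-curve lattice), i.e. n1011's (P-EXP) rider holds at exponent `1` for `Λ` = exponent `0` for `p•Λ` — so
★ PK-6₂ applies to the scaled body VERBATIM (sequel files).  The good ANOMALOUS case (`a_p ≡ 1 mod p`) is NOT
covered (the certificate fails; the semi-local lattice jumps in the tower).

## Contents

* §1 `charSum_natCast_smul`, `zetaBody_smul` —
  `ZetaBody W p f ι κ Λ c d a A z x → ZetaBody W p f ι (m·κ) (m•Λ) c d a A z (m•x)` for every `m : ℕ`.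
* §2 `exists_padicLift_twist_mul` (the integral lift of `p·Vq`; no integrality asked of the `q = p` factor,
  hence no `p² ∣ N`) and `isUnit_sum_coeff_twist_mul_of_certificates` (unit augmentation from R-κ (b), the
  non-anomalous depletion certificate and the 𝔊⁻ certificate).

References: K. Kato, Astérisque 295 (2004) §6.2 p. 161, Thm. 6.6 (1) p. 163, Thm. 9.7 p. 189, Ex. 13.3
[Kato2004Asterisque]; C.-H. Kim, AJM 148 (2026) = arXiv:2203.12159, Lemma 3.3, §3.4–3.5, proof of Thm. 3.13
[Kim2022StructureSelmer]; memo HOME/w2c4/W2C4-PORTSEAM-g7.md §5 (the seat's gen-7 reading these files execute).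
-/

noncomputable section

-- the Theorems namespace of a single-conjunct summit repeats the summit name by design (D-0017)
set_option linter.dupNamespace false

open scoped BigOperators NumberField TensorProduct
open Finset IsDedekindDomain NumberField Field WeierstrassCurve Rat.HeightOneSpectrum MonoidAlgebra
open Literature.NumberTheory.GaloisRepresentations Literature.NumberTheory.GaloisCohomology
open Literature.NumberTheory.EllipticCurves Literature.NumberTheory.EllipticCurves.ModularForms
open Literature.NumberTheory.EllipticCurves.Kato2004
open Literature.NumberTheory.EllipticCurves.Kato2004.EulerSystemValues
open Summit.BirchSwinnertonDyer.Rank1Residual.GaloisImage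

namespace Summit.BirchSwinnertonDyer.BirchSwinnertonDyer.Theorems.KimAtThreeShallowEqDeepZetaBodyScaling

/-! ### §1 `ZetaBody` is homogeneous in `(κ, Λ, x)` -/

section Scaling

variable {W : WeierstrassCurve ℚ} [W.IsElliptic] {p : ℕ} [Fact p.Prime]
  [ContinuousSMul ℤ_[p] (W.tateModule p)] [Module.Free ℤ_[p] (W.tateModule p)]
  [Module.Finite ℤ_[p] (W.tateModule p)] {N : ℕ} {f : CuspForm (CongruenceSubgroup.Gamma0 N) 2}
  {ι : (m : ℕ) → (CyclotomicField m ℚ →+* ℂ)} {κ : ℝ}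
  {Λ : ∀ (k : ℕ) (r : Finset (HeightOneSpectrum (𝓞 ℚ))),
    H1 (tateRep W p) (cycSubgroup p k r) →ₗ[ℤ_[p]] ℚ_[p] ⊗[ℚ] CyclotomicField (cycLevel p k r) ℚ}
  {c d a : ℤ} {A : ℕ}
  {z : ∀ (k : ℕ) (r : (cyclotomicLevelsRat p (badPlaces c d A N)).Ideals),
    H1 (tateRep W p) ((cyclotomicLevelsRat p (badPlaces c d A N)).level k r.1)}
  {x : ∀ (k : ℕ) (r : (cyclotomicLevelsRat p (badPlaces c d A N)).Ideals),
    CyclotomicField (cycLevel p k r.1) ℚ}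

/-- Kato's character sum is `ℚ`-linear in the value: `Σ_b χ(b) ι(σ_b (m·x)) = m · Σ_b χ(b) ι(σ_b x)`.
[folklore] -/
theorem charSum_natCast_smul (n : ℕ) [NeZero n] (ι₀ : CyclotomicField n ℚ →+* ℂ)
    (χ : DirichletCharacter ℂ n) (m : ℕ) (y : CyclotomicField n ℚ) :
    charSum n ι₀ χ ((m : ℚ) • y) = (m : ℂ) * charSum n ι₀ χ y := by
  unfold charSum
  rw [Finset.mul_sum]
  refine Finset.sum_congr rfl fun b _ => ?_
  rw [Algebra.smul_def, map_natCast, map_mul, map_natCast, map_mul, map_natCast]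
  ring

set_option backward.isDefEq.respectTransparency false in
/-- **`ZetaBody` is homogeneous in `(κ, Λ, x)`**: scaling Kato's real constant, the dual-exponential value
datum and the rational values by the same natural number `m` (classes `z` untouched) preserves every clause —
(C1)/(C2) do not mention them, (C3a)/(C3b)/(C4) are linear, (C5) is linear in `x` on the left and in `κ` on the
right.  (Used with `m = p`: the `p`-Euler factor of the depleted value law becomes `p`-integral.)
[cite: Kato2004Asterisque, Thm. 9.7 (p. 189) and Thm. 6.6 (1) (p. 163)] -/
theorem zetaBody_smul (m : ℕ) (hbody : ZetaBody W p f ι κ Λ c d a A z x) :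
    ZetaBody W p f ι ((m : ℝ) * κ) (fun k r => (m : ℤ_[p]) • Λ k r) c d a A z
      (fun k r => (m : ℚ) • x k r) := by
  obtain ⟨h1, h2, h3a, h3b, h4, h5⟩ := hbody
  refine ⟨h1, h2, ?_, ?_, ?_, ?_⟩
  · intro k r σ y
    rw [LinearMap.smul_apply, LinearMap.smul_apply, h3a k r σ y, Nat.cast_smul_eq_nsmul,
      Nat.cast_smul_eq_nsmul, map_nsmul]
  · intro k r y hy
    rw [LinearMap.smul_apply, h3b k r y hy, smul_zero]
  · intro k r
    rw [LinearMap.smul_apply, h4 k r, Nat.cast_smul_eq_nsmul, TensorProduct.tmul_smul,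
      Nat.cast_smul_eq_nsmul]
  · intro k r d' χ Lχ hcd hdd' hL
    obtain ⟨heven, hodd⟩ := h5 k r d' χ Lχ hcd hdd' hL
    refine ⟨fun hχ => ?_, fun hχ => ?_⟩
    · rw [charSum_natCast_smul, heven hχ]
      push_cast
      ring
    · rw [charSum_natCast_smul, hodd hχ]
      push_cast
      ring

end Scaling

/-! ### §2 The integral lift of the `p`-scaled twist and its unit augmentation -/

section Twist

variable (p : ℕ) [Fact p.Prime] {n : ℕ} [NeZero n]

omit [NeZero n] in
/-- **The `p`-SCALED twist `p·Vq = (1 + δ₋₁)·(p·uκ)δ_{u⁻¹}·∏_{q∣M}E_q·C⁻` has an INTEGRAL LIFT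
`V ∈ ℤ_p[(ℤ/n)ˣ]`** as soon as `uκ` and the four cusp symbols are `p`-integral and `p ∣ M`: the factor
`p·E_p = p − a_pδ_{σ_p⁻¹} + 𝟙_{p∤N}δ_{σ_p⁻²}` is integral with NO hypothesis on `a_p` or on `p ∣ N`, and the
factors `E_q`, `q ≠ p`, have `p`-integral scalars `a_q/q`, `𝟙/q` (n1011's `exists_padicLift_twist` with the
`q = p` factor regrouped). [folklore] -/
theorem exists_padicLift_twist_mul {N₀ : ℕ} (f : CuspForm (CongruenceSubgroup.Gamma0 N₀) 2)
    (u : (ZMod n)ˣ) (uκ : ℚ) (M N : ℕ) (hM : M ≠ 0) (hpM : p ∣ M) (uq : ℕ → (ZMod n)ˣ) (aM : ℕ → ℤ)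
    (Eq : MonoidAlgebra ℚ (ZMod n)ˣ)
    (hEq : Eq = ∏ q ∈ M.primeFactors, (1 - MonoidAlgebra.single (uq q)⁻¹ ((aM q : ℚ) / q) +
      MonoidAlgebra.single ((uq q)⁻¹ ^ 2) (if q ∣ N then 0 else (1 / q : ℚ))))
    (c d a d' : ℤ) (A : ℕ) (uc ud : (ZMod n)ˣ)
    (Cq : MonoidAlgebra ℚ (ZMod n)ˣ)
    (hCq : Cq = algebraMap ℚ _ ((c : ℚ) ^ 2 * (d : ℚ) ^ 2 * ratMinusSymbol f ((a : ℚ) / A)) -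
      MonoidAlgebra.single uc ((c : ℚ) * (d : ℚ) ^ 2 * ratMinusSymbol f ((a * c : ℚ) / A)) -
      MonoidAlgebra.single ud ((c : ℚ) ^ 2 * (d : ℚ) * ratMinusSymbol f ((a * d' : ℚ) / A)) +
      MonoidAlgebra.single (uc * ud) ((c : ℚ) * (d : ℚ) * ratMinusSymbol f ((a * c * d' : ℚ) / A)))
    (Vq : MonoidAlgebra ℚ (ZMod n)ˣ)
    (hVq : Vq = (1 + MonoidAlgebra.single (-1 : (ZMod n)ˣ) (1 : ℚ)) *
      MonoidAlgebra.single u⁻¹ ((p : ℚ) * uκ) * Eq * Cq)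
    (huκ : ‖(uκ : ℚ_[p])‖ ≤ 1)
    (hs₁ : ‖((ratMinusSymbol f ((a : ℚ) / A) : ℚ) : ℚ_[p])‖ ≤ 1)
    (hs₂ : ‖((ratMinusSymbol f ((a * c : ℚ) / A) : ℚ) : ℚ_[p])‖ ≤ 1)
    (hs₃ : ‖((ratMinusSymbol f ((a * d' : ℚ) / A) : ℚ) : ℚ_[p])‖ ≤ 1)
    (hs₄ : ‖((ratMinusSymbol f ((a * c * d' : ℚ) / A) : ℚ) : ℚ_[p])‖ ≤ 1) :
    ∃ V : MonoidAlgebra ℤ_[p] (ZMod n)ˣ,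
      MonoidAlgebra.mapRingHom (ZMod n)ˣ (PadicInt.Coe.ringHom (p := p)) V =
        MonoidAlgebra.mapRingHom (ZMod n)ˣ (algebraMap ℚ ℚ_[p]) Vq := by
  classical
  -- the rational group-ring elements whose base change to `ℚ_p` comes from `ℤ_p[G]` form a subring
  let S : Subring (MonoidAlgebra ℚ (ZMod n)ˣ) :=
    (MonoidAlgebra.mapRingHom (ZMod n)ˣ (PadicInt.Coe.ringHom (p := p))).range.comap
      (MonoidAlgebra.mapRingHom (ZMod n)ˣ (algebraMap ℚ ℚ_[p]))
  have hsingle : ∀ (g : (ZMod n)ˣ) {q : ℚ}, ‖(q : ℚ_[p])‖ ≤ 1 → MonoidAlgebra.single g q ∈ S :=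
    fun g q h => Subring.mem_comap.mpr (by
      rw [MonoidAlgebra.mapRingHom_single]
      exact ValueRow.single_algebraMap_mem_range_mapRingHom p g h)
  have halg : ∀ {q : ℚ}, ‖(q : ℚ_[p])‖ ≤ 1 → algebraMap ℚ (MonoidAlgebra ℚ (ZMod n)ˣ) q ∈ S :=
    fun h => Subring.mem_comap.mpr (ValueRow.algebraMap_mem_range_mapRingHom p h)
  suffices h : Vq ∈ S by
    obtain ⟨V, hV⟩ := Subring.mem_comap.mp h
    exact ⟨V, hV⟩
  have hp : (p : ℚ) ≠ 0 := Nat.cast_ne_zero.mpr (Fact.out : p.Prime).ne_zero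
  have hpmem : p ∈ M.primeFactors := Nat.mem_primeFactors.mpr ⟨Fact.out, hpM, hM⟩
  have halgs : ∀ q : ℚ, algebraMap ℚ (MonoidAlgebra ℚ (ZMod n)ˣ) q = MonoidAlgebra.single 1 q :=
    fun _ => rfl
  have hc : ‖((c : ℚ) : ℚ_[p])‖ ≤ 1 := ValueRow.norm_ratCast_intCast_le_one p c
  have hd : ‖((d : ℚ) : ℚ_[p])‖ ≤ 1 := ValueRow.norm_ratCast_intCast_le_one p d
  have hc2 : ‖(((c : ℚ) ^ 2 : ℚ) : ℚ_[p])‖ ≤ 1 := by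
    rw [sq]; exact ValueRow.norm_ratCast_mul_le_one p hc hc
  have hd2 : ‖(((d : ℚ) ^ 2 : ℚ) : ℚ_[p])‖ ≤ 1 := by
    rw [sq]; exact ValueRow.norm_ratCast_mul_le_one p hd hd
  -- the Euler factors
  set E : ℕ → MonoidAlgebra ℚ (ZMod n)ˣ := fun q =>
    1 - MonoidAlgebra.single (uq q)⁻¹ ((aM q : ℚ) / q) +
      MonoidAlgebra.single ((uq q)⁻¹ ^ 2) (if q ∣ N then 0 else (1 / q : ℚ)) with hE
  -- (i) the regrouped `p`-factor `p · E_p = p − a_p δ + 𝟙 δ²` is integral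
  have hEp : algebraMap ℚ (MonoidAlgebra ℚ (ZMod n)ˣ) (p : ℚ) * E p ∈ S := by
    have hrw : algebraMap ℚ (MonoidAlgebra ℚ (ZMod n)ˣ) (p : ℚ) * E p =
        algebraMap ℚ (MonoidAlgebra ℚ (ZMod n)ˣ) (p : ℚ) -
          MonoidAlgebra.single (uq p)⁻¹ ((aM p : ℚ)) +
          MonoidAlgebra.single ((uq p)⁻¹ ^ 2) (if p ∣ N then 0 else (1 : ℚ)) := by
      by_cases hpN : p ∣ N
      · simp only [hE, if_pos hpN, halgs, mul_add, mul_sub, mul_one, MonoidAlgebra.single_mul_single,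
          one_mul, mul_zero, mul_div_cancel₀ _ hp]
      · simp only [hE, if_neg hpN, halgs, mul_add, mul_sub, mul_one, MonoidAlgebra.single_mul_single,
          one_mul, one_div, mul_inv_cancel₀ hp, mul_div_cancel₀ _ hp]
    rw [hrw]
    refine add_mem (sub_mem (halg ?_) (hsingle _ (ValueRow.norm_ratCast_intCast_le_one p _)))
      (hsingle _ ?_)
    · exact_mod_cast Padic.norm_int_le_one (p : ℤ)
    · split_ifs
      · rw [Rat.cast_zero, norm_zero]; exact zero_le_one
      · rw [Rat.cast_one, norm_one]
  -- (ii) the factors at `q ≠ p` have `p`-integral scalars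
  have hEq' : ∀ q ∈ M.primeFactors.erase p, E q ∈ S := by
    intro q hq
    obtain ⟨hqp, hqM⟩ := Finset.mem_erase.mp hq
    have hqprime : q.Prime := Nat.prime_of_mem_primeFactors hqM
    refine add_mem (sub_mem (one_mem S) (hsingle _ (ValueRow.norm_ratCast_div_le_one_of_ne p hqprime hqp _)))
      (hsingle _ ?_)
    split_ifs
    · rw [Rat.cast_zero, norm_zero]; exact zero_le_one
    · have h := ValueRow.norm_ratCast_div_le_one_of_ne p hqprime hqp 1
      rwa [Int.cast_one] at h
  -- (iii) regroup `Vq`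
  have hsplit : MonoidAlgebra.single u⁻¹ ((p : ℚ) * uκ) =
      MonoidAlgebra.single u⁻¹ uκ * algebraMap ℚ (MonoidAlgebra ℚ (ZMod n)ˣ) (p : ℚ) := by
    rw [halgs, MonoidAlgebra.single_mul_single, mul_one, mul_comm uκ]
  have hkey : Vq = ((1 + MonoidAlgebra.single (-1 : (ZMod n)ˣ) (1 : ℚ)) * MonoidAlgebra.single u⁻¹ uκ) *
      ((algebraMap ℚ (MonoidAlgebra ℚ (ZMod n)ˣ) (p : ℚ) * E p) * ∏ q ∈ M.primeFactors.erase p, E q) * Cq := by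
    rw [hVq, hEq, ← Finset.mul_prod_erase _ _ hpmem, hsplit]
    ring
  rw [hkey]
  refine mul_mem (mul_mem (mul_mem (add_mem (one_mem S) (hsingle _ ?_)) (hsingle _ huκ))
    (mul_mem hEp (prod_mem fun q hq => hEq' q hq))) ?_
  · rw [Rat.cast_one, norm_one]
  · rw [hCq]
    refine add_mem (sub_mem (sub_mem (halg ?_) (hsingle _ ?_)) (hsingle _ ?_)) (hsingle _ ?_)
    · exact ValueRow.norm_ratCast_mul_le_one p (ValueRow.norm_ratCast_mul_le_one p hc2 hd2) hs₁
    · exact ValueRow.norm_ratCast_mul_le_one p (ValueRow.norm_ratCast_mul_le_one p hc hd2) hs₂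
    · exact ValueRow.norm_ratCast_mul_le_one p (ValueRow.norm_ratCast_mul_le_one p hc2 hd) hs₃
    · exact ValueRow.norm_ratCast_mul_le_one p (ValueRow.norm_ratCast_mul_le_one p hc hd) hs₄

/-- **The integral lift of the `p`-scaled twist has UNIT AUGMENTATION** from R-κ (b) (`uκ ≠ 0`,
`v_p(uκ) = 0`), the NON-ANOMALOUS depletion certificate `v_p(p · ∏_{q∣M}(1 − a_q/q + 𝟙_{q∤N}/q)) = 0` (at
`M = pA`: the `q = p` factor of `p·E` is `p + 𝟙_{p∤N} − a_p`, i.e. `#Ẽ(𝔽_p)` at a good `p`, `p ∓ 1` at a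
multiplicative `p`) and the 𝔊⁻ certificate `R⁻ ≠ 0`, `v_p(R⁻) = 0`: `aug(p·Vq) = 2·uκ·(p·∏E_q(1))·R⁻`.
[cite: Kim2022StructureSelmer, the proof of Thm. 3.13 (arXiv v3 pp. 26–28; = Thm. 3.11 of AJM 148)]
[cite: Kato2004Asterisque, §6.2 (p. 161) and Thm. 6.6 (1) (p. 163)] -/
theorem isUnit_sum_coeff_twist_mul_of_certificates (hp2 : p ≠ 2) {N₀ : ℕ}
    (f : CuspForm (CongruenceSubgroup.Gamma0 N₀) 2)
    (u : (ZMod n)ˣ) (uκ : ℚ) (M N : ℕ) (uq : ℕ → (ZMod n)ˣ) (aM : ℕ → ℤ)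
    (Eq : MonoidAlgebra ℚ (ZMod n)ˣ)
    (hEq : Eq = ∏ q ∈ M.primeFactors, (1 - MonoidAlgebra.single (uq q)⁻¹ ((aM q : ℚ) / q) +
      MonoidAlgebra.single ((uq q)⁻¹ ^ 2) (if q ∣ N then 0 else (1 / q : ℚ))))
    (c d a d' : ℤ) (A : ℕ) (uc ud : (ZMod n)ˣ)
    (Cq : MonoidAlgebra ℚ (ZMod n)ˣ)
    (hCq : Cq = algebraMap ℚ _ ((c : ℚ) ^ 2 * (d : ℚ) ^ 2 * ratMinusSymbol f ((a : ℚ) / A)) -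
      MonoidAlgebra.single uc ((c : ℚ) * (d : ℚ) ^ 2 * ratMinusSymbol f ((a * c : ℚ) / A)) -
      MonoidAlgebra.single ud ((c : ℚ) ^ 2 * (d : ℚ) * ratMinusSymbol f ((a * d' : ℚ) / A)) +
      MonoidAlgebra.single (uc * ud) ((c : ℚ) * (d : ℚ) * ratMinusSymbol f ((a * c * d' : ℚ) / A)))
    (Vq : MonoidAlgebra ℚ (ZMod n)ˣ)
    (hVq : Vq = (1 + MonoidAlgebra.single (-1 : (ZMod n)ˣ) (1 : ℚ)) *
      MonoidAlgebra.single u⁻¹ ((p : ℚ) * uκ) * Eq * Cq)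
    (V : MonoidAlgebra ℤ_[p] (ZMod n)ˣ)
    (hV : MonoidAlgebra.mapRingHom (ZMod n)ˣ (PadicInt.Coe.ringHom (p := p)) V =
      MonoidAlgebra.mapRingHom (ZMod n)ˣ (algebraMap ℚ ℚ_[p]) Vq)
    (huκ0 : uκ ≠ 0) (huκ : padicValRat p uκ = 0)
    (hE0 : ∏ q ∈ M.primeFactors, (1 - (aM q : ℚ) / q + (if q ∣ N then 0 else (1 / q : ℚ))) ≠ 0)
    (hE : padicValRat p ((p : ℚ) *
      ∏ q ∈ M.primeFactors, (1 - (aM q : ℚ) / q + (if q ∣ N then 0 else (1 / q : ℚ)))) = 0)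
    (hR0 : (c : ℚ) ^ 2 * (d : ℚ) ^ 2 * ratMinusSymbol f ((a : ℚ) / A) -
        (c : ℚ) * (d : ℚ) ^ 2 * ratMinusSymbol f ((a * c : ℚ) / A) -
        (c : ℚ) ^ 2 * (d : ℚ) * ratMinusSymbol f ((a * d' : ℚ) / A) +
        (c : ℚ) * (d : ℚ) * ratMinusSymbol f ((a * c * d' : ℚ) / A) ≠ 0)
    (hR : padicValRat p ((c : ℚ) ^ 2 * (d : ℚ) ^ 2 * ratMinusSymbol f ((a : ℚ) / A) -
        (c : ℚ) * (d : ℚ) ^ 2 * ratMinusSymbol f ((a * c : ℚ) / A) -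
        (c : ℚ) ^ 2 * (d : ℚ) * ratMinusSymbol f ((a * d' : ℚ) / A) +
        (c : ℚ) * (d : ℚ) * ratMinusSymbol f ((a * c * d' : ℚ) / A)) = 0) :
    IsUnit (∑ g : (ZMod n)ˣ, V.coeff g) := by
  have hp : (p : ℚ) ≠ 0 := Nat.cast_ne_zero.mpr (Fact.out : p.Prime).ne_zero
  have haug := ValueRow.sum_coeff_twist_eq f u ((p : ℚ) * uκ) M N uq aM Eq hEq c d a d' A uc ud Cq hCq Vq hVq
  -- `aug Vq = 2 · uκ · (p · E) · R⁻`
  have haug' : ∑ g : (ZMod n)ˣ, Vq.coeff g = 2 * uκ *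
      ((p : ℚ) * ∏ q ∈ M.primeFactors, (1 - (aM q : ℚ) / q + (if q ∣ N then 0 else (1 / q : ℚ)))) *
      ((c : ℚ) ^ 2 * (d : ℚ) ^ 2 * ratMinusSymbol f ((a : ℚ) / A) -
        (c : ℚ) * (d : ℚ) ^ 2 * ratMinusSymbol f ((a * c : ℚ) / A) -
        (c : ℚ) ^ 2 * (d : ℚ) * ratMinusSymbol f ((a * d' : ℚ) / A) +
        (c : ℚ) * (d : ℚ) * ratMinusSymbol f ((a * c * d' : ℚ) / A)) := by
    rw [haug]; ring
  have hpE0 : (p : ℚ) * ∏ q ∈ M.primeFactors,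
      (1 - (aM q : ℚ) / q + (if q ∣ N then 0 else (1 / q : ℚ))) ≠ 0 := mul_ne_zero hp hE0
  refine ValueRow.isUnit_sum_coeff_of_padicValRat_eq_zero p V Vq hV ?_ ?_
  · rw [haug']
    exact mul_ne_zero (mul_ne_zero (mul_ne_zero two_ne_zero huκ0) hpE0) hR0
  · rw [haug', padicValRat.mul (mul_ne_zero (mul_ne_zero two_ne_zero huκ0) hpE0) hR0,
      padicValRat.mul (mul_ne_zero two_ne_zero huκ0) hpE0, padicValRat.mul two_ne_zero huκ0, huκ, hE, hR]
    have h2 : padicValRat p 2 = 0 := by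
      rw [show (2 : ℚ) = ((2 : ℕ) : ℚ) by norm_num, padicValRat.of_nat]
      norm_cast
      exact padicValNat.eq_zero_of_not_dvd fun h =>
        hp2 ((Nat.prime_dvd_prime_iff_eq Fact.out Nat.prime_two).1 h)
    rw [h2]
    ring

end Twist

end Summit.BirchSwinnertonDyer.BirchSwinnertonDyer.Theorems.KimAtThreeShallowEqDeepZetaBodyScaling

end
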